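/-
COR-CM (cell pub-hodgecm2, stage 2 of the Hodge ladder) — count-neutral KERNEL COMBINATORICS «the index-two cyclic law», part XXII: THE MIXED TWISTS,
III — THE TRICHOTOMY AND THE LAW UP TO THE OCTIC LEVEL (seat prover-pub-hodgecm2-b23-g56-0, binder prover b23, gen 56; claim «INDEX-TWO CYCLIC —
THE MIXED TWISTS», HOME/INBOX.md l.26438).  Theorems only, on parts VI, IX, X, XI, XX, XXI and seat b23 gen 48ʼs dihedral law BY NAME; no definition,
no `decide`, no certificate, no named fact, no `sorry`; `Interfaces.lean` (C1), every E term, B01, `Transposition/*`, `PortJoin/*`, `D2Bridge/*` untouched.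
HONEST FRAMING: `HC_CM` is NOT proved, here or anywhere in the tree; nothing here is a period, a count of record or a headline.
T5: n/a-class (hypothesis binders = the fields of `IndexTwoCyclic.Datum` / the elements `u, w`, `c·c = 1`, `c ≠ 1`, `Even n`, and the case
hypothesis; inhabited by part VIIʼs `SplitGroup n r`; checker: self).
-/
import Summits.HodgeConjecture.CorCM.Census.IndexTwoCyclicMixedOctic
import Summits.HodgeConjecture.CorCM.Census.IndexTwoCyclicTwoPower

/-!
# The index-two cyclic law, XXII: the mixed twists, III — the trichotomy and `μ = φ₂` up to the octic level

THE SETTING of parts XX–XXI: an index-two cyclic datum `D` for `(G, c)` of even level `n` (`G ≅ ℤ/2n ⋊_r ℤ/2`, `c = uⁿ`), `v = u^{r+1} = (w·u)²`.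

* §1 **THE TRICHOTOMY** (`trichotomy`): EITHER `c ∈ ⟨v⟩` (the TWIST side: `d₂ = 1`, `μ = φ₂ = β − 1`, part VI), OR `v = 1` (the DIHEDRAL side:
  every non-rotation is an involution, seat b23 gen 48: `μ = φ₂ = β − 2`), OR `c ∉ ⟨v⟩` and `v ≠ 1` (the MIXED side: `G = D_{4n/j} × C_j` with
  `j = orderOf v` odd `≥ 3`, part XX; `β − 2 = φ₂ ≤ μ ≤ β − 1`, part IX).  `isLeast_card_gfaces_generate_fibreTwo_of_twist_eq_one`: the dihedral side
  at every level (part XI had it at 2-power level only).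
* §2 **THE LAW UP TO THE OCTIC LEVEL** (`isLeast_card_gfaces_generate_fibreTwo_of_le_octic`): if on the mixed side the dihedral factor has order `8`
  (`n = 2·orderOf v`, part XXI), then in all three cases **`μ(G, c) = φ₂(G, c)`**; block currency `β − (1 if c ∈ ⟨v⟩ else 2)`.  So the column
  «split index-two cyclic data» is now closed EXCEPT for the mixed twists whose dihedral factor has order `≥ 16` (`D(ℤ/8) × C₃ = (24, 7)`, order `48`,
  the smallest).
* §3 **STRUCTURE-FREE FORMS** from `u, w` alone (`orderOf u = 2n`, `[G : ⟨u⟩] = 2`, `uⁿ = c`, `w ∉ ⟨u⟩` an involution; the twist element is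
  `(w·u)²`, part X): `isLeast_card_gfaces_generate_fibreTwo_of_involution_octic_level` and `…_of_involution_le_octic`.

## References
* [Pohlmann1968] H. Pohlmann, Algebraic cycles on abelian varieties of complex multiplication type, Ann. of Math. 88 (1968), Thm 1.
* [Milne1999] J. S. Milne, Lefschetz motives and the Tate conjecture, Compositio Math. 117 (1999), Prop. 2.1, p. 54.
-/

namespace Summit.HodgeConjecture.CorCM.Census.IndexTwoCyclic

open Finset
open Summit.HodgeConjecture.CorCM.Prior.AllgGroup.RfwfAllgGroup
open Summit.HodgeConjecture.CorCM.Census.BlockParity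
open Summit.HodgeConjecture.CorCM.Census.Coinvariant

noncomputable section

variable {G : Type*} [Group G] [Fintype G] [DecidableEq G] {c : G} {n : ℕ} [NeZero n]
variable (D : Datum G c n)

/-! ## §1 The trichotomy; the dihedral side at every level -/

omit [Fintype G] [DecidableEq G] [NeZero n] in
include D in
/-- **THE TRICHOTOMY of split index-two cyclic data**: twist side, dihedral side, or mixed side. [folklore] -/
theorem trichotomy :
    c ∈ Subgroup.zpowers (D.u ^ (D.r + 1)) ∨ D.u ^ (D.r + 1) = 1 ∨ (c ∉ Subgroup.zpowers (D.u ^ (D.r + 1)) ∧ D.u ^ (D.r + 1) ≠ 1) := by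
  by_cases h : c ∈ Subgroup.zpowers (D.u ^ (D.r + 1))
  · exact Or.inl h
  · by_cases hv : D.u ^ (D.r + 1) = 1
    · exact Or.inr (Or.inl hv)
    · exact Or.inr (Or.inr ⟨h, hv⟩)

omit [Fintype G] [DecidableEq G] [NeZero n] in
/-- `v = 1` iff `2n ∣ r + 1` (the dihedral side). [folklore] -/
theorem twist_eq_one_iff : D.u ^ (D.r + 1) = 1 ↔ 2 * n ∣ D.r + 1 := by
  rw [← D.hord]; exact orderOf_dvd_iff_pow_eq_one.symm

/-- **The dihedral side at every level**: `v = 1` ⟹ every non-rotation is an involution ⟹ seat b23 gen 48ʼs DIHEDRAL LAW `μ = φ₂ (= β − 2)`. [folklore] -/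
theorem isLeast_card_gfaces_generate_fibreTwo_of_twist_eq_one (hc2 : c * c = 1) (hc1 : c ≠ 1) (hv : D.u ^ (D.r + 1) = 1) :
    IsLeast {m : ℕ | ∃ S : Finset (CMF G c →₀ ℤ), ↑S ⊆ gfaceSet G c hc2 ∧ S.card = m ∧
      hodgeSpan c hc2 ≤ Submodule.span ℤ (pairSet c) ⊔ Submodule.span ℤ (translates c S)} (fibreTwo c hc2) := by
  obtain ⟨E, -, -⟩ := nonempty_dihedralDatum_of_dvd D ((twist_eq_one_iff D).mp hv)
  exact Dihedral.isLeast_card_gfaces_generate_fibreTwo E hc2 hc1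

/-- Block currency on the dihedral side: `μ = β − 2`. [folklore] -/
theorem isLeast_card_gfaces_generate_of_twist_eq_one (hc2 : c * c = 1) (hc1 : c ≠ 1) (hv : D.u ^ (D.r + 1) = 1) :
    IsLeast {m : ℕ | ∃ S : Finset (CMF G c →₀ ℤ), ↑S ⊆ gfaceSet G c hc2 ∧ S.card = m ∧
      hodgeSpan c hc2 ≤ Submodule.span ℤ (pairSet c) ⊔ Submodule.span ℤ (translates c S)} (Fintype.card (Block c) - 2) := by
  obtain ⟨E, -, -⟩ := nonempty_dihedralDatum_of_dvd D ((twist_eq_one_iff D).mp hv)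
  exact Dihedral.isLeast_card_gfaces_generate E hc2 hc1

/-! ## §2 The law up to the octic level -/

/-- **THE INDEX-TWO CYCLIC LAW UP TO THE OCTIC LEVEL: `μ(G, c) = φ₂(G, c)`** for every split index-two cyclic datum of even level whose mixed
side (if it is on the mixed side) has dihedral factor of order `8` (`n = 2·orderOf u^{r+1}`): twist side by part VI, dihedral side by gen 48, mixed
octic side by part XXI. [folklore] -/
theorem isLeast_card_gfaces_generate_fibreTwo_of_le_octic (hc2 : c * c = 1) (hc1 : c ≠ 1) (hn : Even n)
    (hoct : c ∉ Subgroup.zpowers (D.u ^ (D.r + 1)) → D.u ^ (D.r + 1) ≠ 1 → n = 2 * orderOf (D.u ^ (D.r + 1))) :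
    IsLeast {m : ℕ | ∃ S : Finset (CMF G c →₀ ℤ), ↑S ⊆ gfaceSet G c hc2 ∧ S.card = m ∧
      hodgeSpan c hc2 ≤ Submodule.span ℤ (pairSet c) ⊔ Submodule.span ℤ (translates c S)} (fibreTwo c hc2) := by
  rcases trichotomy D with h | hv | ⟨h, hv⟩
  · exact isLeast_card_gfaces_generate_fibreTwo_of_twist D hc2 hc1 hn h
  · exact isLeast_card_gfaces_generate_fibreTwo_of_twist_eq_one D hc2 hc1 hv
  · exact isLeast_card_gfaces_generate_fibreTwo_of_octic_level D hc2 hc1 h hv (hoct h hv)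

/-- **Block currency up to the octic level: `μ = β − (1 if c ∈ ⟨u^{r+1}⟩ else 2)`.** [folklore] -/
theorem isLeast_card_gfaces_generate_of_le_octic (hc2 : c * c = 1) (hc1 : c ≠ 1) (hn : Even n)
    (hoct : c ∉ Subgroup.zpowers (D.u ^ (D.r + 1)) → D.u ^ (D.r + 1) ≠ 1 → n = 2 * orderOf (D.u ^ (D.r + 1))) :
    IsLeast {m : ℕ | ∃ S : Finset (CMF G c →₀ ℤ), ↑S ⊆ gfaceSet G c hc2 ∧ S.card = m ∧
      hodgeSpan c hc2 ≤ Submodule.span ℤ (pairSet c) ⊔ Submodule.span ℤ (translates c S)}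
      (Fintype.card (Block c) - if c ∈ Subgroup.zpowers (D.u ^ (D.r + 1)) then 1 else 2) := by
  rw [card_block_eq_fibreTwo_add D hc2 hc1 hn, Nat.add_sub_cancel]
  exact isLeast_card_gfaces_generate_fibreTwo_of_le_octic D hc2 hc1 hn hoct

/-- **THE LEVEL `n = 2j`, MIXED SIDE WITH `orderOf u^{r+1} = j`** — the statement of part XXI with the level written as data: for `n = 2j` and a
mixed twist with `orderOf u^{r+1} = j` (e.g. `r ≡ 3 (mod 4)`, `r ≡ 1 (mod j)`): `μ = φ₂`. [folklore] -/
theorem isLeast_card_gfaces_generate_fibreTwo_of_orderOf_twist_eq {j : ℕ} (hc2 : c * c = 1) (hc1 : c ≠ 1) (hn : n = 2 * j)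
    (h : c ∉ Subgroup.zpowers (D.u ^ (D.r + 1))) (hj : orderOf (D.u ^ (D.r + 1)) = j) (hj1 : j ≠ 1) :
    IsLeast {m : ℕ | ∃ S : Finset (CMF G c →₀ ℤ), ↑S ⊆ gfaceSet G c hc2 ∧ S.card = m ∧
      hodgeSpan c hc2 ≤ Submodule.span ℤ (pairSet c) ⊔ Submodule.span ℤ (translates c S)} (fibreTwo c hc2) := by
  have hv : D.u ^ (D.r + 1) ≠ 1 := fun e => hj1 (by rw [← hj, e, orderOf_one])
  exact isLeast_card_gfaces_generate_fibreTwo_of_octic_level D hc2 hc1 h hv (by rw [hj]; exact hn)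

/-! ## §3 Structure-free forms -/

omit [NeZero n] in
/-- **STRUCTURE-FREE FORM OF THE OCTIC MIXED LEVEL.**  In a finite group let `u` have order `2n` with `[G : ⟨u⟩] = 2`, `c = uⁿ ≠ 1`, and let
`w ∉ ⟨u⟩` be an involution; put `v := (w·u)²`.  If `c ∉ ⟨v⟩`, `v ≠ 1` and `n = 2·orderOf v` — `G ≅ D₄ × C_{orderOf v}` — then `μ(G, c) = φ₂(G, c)`.
[folklore] -/
theorem isLeast_card_gfaces_generate_fibreTwo_of_involution_octic_level [NeZero n] (u w : G) (hun : u ^ n = c) (hord : orderOf u = 2 * n)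
    (hindex : (Subgroup.zpowers u).index = 2) (hw : w ∉ Subgroup.zpowers u) (hww : w * w = 1) (hc2 : c * c = 1) (hc1 : c ≠ 1)
    (h : c ∉ Subgroup.zpowers ((w * u) ^ 2)) (hv : (w * u) ^ 2 ≠ 1) (hn : n = 2 * orderOf ((w * u) ^ 2)) :
    IsLeast {m : ℕ | ∃ S : Finset (CMF G c →₀ ℤ), ↑S ⊆ gfaceSet G c hc2 ∧ S.card = m ∧
      hodgeSpan c hc2 ≤ Submodule.span ℤ (pairSet c) ⊔ Submodule.span ℤ (translates c S)} (fibreTwo c hc2) := by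
  obtain ⟨D, hDu, hDw⟩ := exists_datum_of_involution (c := c) u w hun hord hindex hw hww
  have hsq : (w * u) ^ 2 = D.u ^ (D.r + 1) := by rw [← hDu, ← hDw]; exact w_mul_u_sq D
  rw [hsq] at h hv hn
  exact isLeast_card_gfaces_generate_fibreTwo_of_octic_level D hc2 hc1 h hv hn

omit [NeZero n] in
/-- **STRUCTURE-FREE FORM UP TO THE OCTIC LEVEL**: same data, `n` even, and the case hypothesis `c ∉ ⟨(wu)²⟩ → (wu)² ≠ 1 → n = 2·orderOf (wu)²`
⟹ `μ(G, c) = φ₂(G, c)`. [folklore] -/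
theorem isLeast_card_gfaces_generate_fibreTwo_of_involution_le_octic [NeZero n] (u w : G) (hun : u ^ n = c) (hord : orderOf u = 2 * n)
    (hindex : (Subgroup.zpowers u).index = 2) (hw : w ∉ Subgroup.zpowers u) (hww : w * w = 1) (hc2 : c * c = 1) (hc1 : c ≠ 1) (hn : Even n)
    (hoct : c ∉ Subgroup.zpowers ((w * u) ^ 2) → (w * u) ^ 2 ≠ 1 → n = 2 * orderOf ((w * u) ^ 2)) :
    IsLeast {m : ℕ | ∃ S : Finset (CMF G c →₀ ℤ), ↑S ⊆ gfaceSet G c hc2 ∧ S.card = m ∧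
      hodgeSpan c hc2 ≤ Submodule.span ℤ (pairSet c) ⊔ Submodule.span ℤ (translates c S)} (fibreTwo c hc2) := by
  obtain ⟨D, hDu, hDw⟩ := exists_datum_of_involution (c := c) u w hun hord hindex hw hww
  have hsq : (w * u) ^ 2 = D.u ^ (D.r + 1) := by rw [← hDu, ← hDw]; exact w_mul_u_sq D
  rw [hsq] at hoct
  exact isLeast_card_gfaces_generate_fibreTwo_of_le_octic D hc2 hc1 hn hoct

/-! ## §4 Appendix (same seat, same session): the octic mixed level read from orders alone -/

omit [NeZero n] in
/-- **`D₄ × C_j` FROM TWO ELEMENTS AND THEIR ORDERS.**  In a finite group let `u` have order `2n = 4j` (`j` odd, `j ≥ 3`) with `[G : ⟨u⟩] = 2`,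
`c = uⁿ ≠ 1`, `c² = 1`, and let `w ∉ ⟨u⟩` be an involution with **`orderOf (w·u)² = j`**.  Then `μ(G, c) = φ₂(G, c)`: the twist element `(w·u)²` has
odd order (so `c ∉ ⟨(wu)²⟩`), is `≠ 1`, and `n = 2j` is the octic level of part XXI. [folklore] -/
theorem isLeast_card_gfaces_generate_fibreTwo_of_involution_orderOf_sq [NeZero n] {j : ℕ} (u w : G) (hun : u ^ n = c) (hord : orderOf u = 2 * n)
    (hindex : (Subgroup.zpowers u).index = 2) (hw : w ∉ Subgroup.zpowers u) (hww : w * w = 1) (hc2 : c * c = 1) (hc1 : c ≠ 1)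
    (hn : n = 2 * j) (hj : Odd j) (h3 : 3 ≤ j) (hsq : orderOf ((w * u) ^ 2) = j) :
    IsLeast {m : ℕ | ∃ S : Finset (CMF G c →₀ ℤ), ↑S ⊆ gfaceSet G c hc2 ∧ S.card = m ∧
      hodgeSpan c hc2 ≤ Submodule.span ℤ (pairSet c) ⊔ Submodule.span ℤ (translates c S)} (fibreTwo c hc2) := by
  have h2 : orderOf c = 2 := orderOf_eq_prime (by rw [pow_two, hc2]) hc1
  have h : c ∉ Subgroup.zpowers ((w * u) ^ 2) := fun hc => by
    have hdvd := orderOf_dvd_of_mem_zpowers hc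
    rw [h2, hsq] at hdvd
    exact hj.not_two_dvd_nat hdvd
  have hv : (w * u) ^ 2 ≠ 1 := fun e => by
    have h1 : orderOf ((w * u) ^ 2) = 1 := by rw [e, orderOf_one]
    omega
  exact isLeast_card_gfaces_generate_fibreTwo_of_involution_octic_level u w hun hord hindex hw hww hc2 hc1 h hv (by rw [hsq]; exact hn)

end

end Summit.HodgeConjecture.CorCM.Census.IndexTwoCyclic
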